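import Summits.QuantumFields.YangMills.Theorems.TwistedTraceScaling.Negative.TubePackageIffInner
import Summits.QuantumFields.YangMills.Theorems.LuscherReductionTwistedTraceScalingRecordWeightRho
import HarnessLib

/-!
# R31 — lane A's new target of record with FREE fat radius, `SoftTubeBOPackageAt L (recordWeightRho δ ρ δg)`, is INNER one-orbit at `δ` — the fat radius `ρ ≥ 2δ` and the gauge width
# `δg` are DECORATIVE in the typed statement (crux disprover of `TwistedTraceScaling`, stmt-QuantumFields-20203, cycle 23; `--supports`; negative lane, def-free)

COARSE-DESIGN §23.9 / `…RecordWeightRho` (p630346) frees the fat radius of the record weight: `recordWeightRho δ ρ δg = 𝟙_{nearOne(ρβ) ∩ {orbitDist < δβ}}·e^{−gaugeCoordSq/δg²}`,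
target of record `SoftTubeBOPackageAt L (recordWeightRho (powScale s) (M·powScale s) (powScale 1))`, `M ≥ 2`, and re-derives C4-CORE from it
(`innerNoIntruderOneOrbitAt_pow_of_recordWeightRho_package`).  THIS FILE closes the circle as R27/R27b did for `ρ = 2δ`:
* `recordWeightRho_ge_of_ne_zero` (on its support the weight is `≥ e^{−|E|/δg²}`), `orbitDist_lt_of_recordWeightRho_ne_zero`;
* ★★ `softTube_recordWeightRho_iff_inner`, ★★ `softTubeBOPackage_recordWeightRho_iff_inner`: for all positive `δ`, ALL `ρ ≥ 2δ` and ALL `δg`,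
  `SoftTubeBOPackageAt L (recordWeightRho δ ρ δg) ↔ SoftTubeNoIntruderAt L (recordWeightRho δ ρ δg) ↔ InnerNoIntruderOneOrbitAt L δ`;
* ★★ `softTubeBOPackage_recordWeightRho_pow_iff` (the instance of record, every `s, t, M ≥ 2`) and ★ `softTubeBOPackage_recordWeightRho_pow_iff_recordWeight`: the new target
  is EQUIVALENT to the old one (`recordWeight (powScale s) (powScale t')`, any `t'`) — `M`, `t` carry no content in the typed target; they matter only INSIDE a proof (chart coverage,
  the single-slice evaluation (N2), cf. R29: `nearOne(ρβ)` must still exclude the winding copies, i.e. `ρβ ≤ 2√(1 − cos(2π/L))` eventually — true for `ρ = M·β^{−s}`, `s > 0`).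
So C4-CORE's typed target still has 0 bytes beyond INNER one-orbit at `powScale s` (R18/R27/R27b/R31).  HONEST FRAMING: bookkeeping about the typed interface of stub S-BASE's
sub-target C4 of a child of the CONDITIONAL reduction route R2b1; no kernel estimate refuted or proved; C4 OPEN; not a gap, not Clay.

## References
* M. Lüscher, Some analytic results concerning the mass spectrum of Yang–Mills gauge theories on a torus, Nucl. Phys. B219 (1983) 233–261, §3. [Luscher1983]
-/

set_option autoImplicit false

noncomputable section

open MeasureTheory Filter Topology Real
open scoped BigOperators
open Literature.MathematicalPhysics.QuantumFieldTheory hiding SU2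
open Literature.MathematicalPhysics.QuantumLattice
open Summit.QuantumFields.YangMills.Theorems.FemtoTransferGap
open Summit.QuantumFields.YangMills.Theorems.FemtoTransferGap.TwoLattice.ConstTube
open Summit.QuantumFields.YangMills.Theorems.TwistedTraceScaling.Negative.R27
open Summit.QuantumFields.YangMills.Theorems.TwistedTraceScaling.Negative.R27b

namespace Summit.QuantumFields.YangMills.Theorems.TwistedTraceScaling.Negative.R31

variable {L : ℕ} [NeZero L]

/-- The free-radius weight is nonnegative. [folklore] -/
theorem recordWeightRho_nonneg (δ ρ δg : ℝ → ℝ) (β : ℝ) (U : GaugeConfig 3 L SU2) : 0 ≤ recordWeightRho L δ ρ δg β U :=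
  (recordWeightRho_mem_Icc L δ ρ δg β U).1

/-- Where the free-radius weight is nonzero the configuration lies in the fat tube `fatTubeRho`. [folklore] -/
theorem mem_fatTubeRho_of_recordWeightRho_ne_zero (δ ρ δg : ℝ → ℝ) (β : ℝ) {U : GaugeConfig 3 L SU2} (hU : recordWeightRho L δ ρ δg β U ≠ 0) :
    U ∈ fatTubeRho L δ ρ β := by
  by_contra h
  exact hU (by rw [recordWeightRho, Set.indicator_of_notMem h, zero_mul])

/-- On its support the free-radius weight is at least `exp(−|E|/δg²)`. [folklore] -/
theorem recordWeightRho_ge_of_ne_zero (δ ρ δg : ℝ → ℝ) (β : ℝ) {U : GaugeConfig 3 L SU2} (hU : recordWeightRho L δ ρ δg β U ≠ 0) :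
    Real.exp (-((Fintype.card (Edge 3 L) : ℝ) / δg β ^ 2)) ≤ recordWeightRho L δ ρ δg β U := by
  rw [recordWeightRho, Set.indicator_of_mem (mem_fatTubeRho_of_recordWeightRho_ne_zero δ ρ δg β hU), one_mul]
  exact gaussFactor_ge L δg β U

/-- The free-radius weight is supported in the inner region `{orbitDist < δ β}` (whatever `ρ`). [folklore] -/
theorem orbitDist_lt_of_recordWeightRho_ne_zero (δ ρ δg : ℝ → ℝ) (β : ℝ) {U : GaugeConfig 3 L SU2} (hU : recordWeightRho L δ ρ δg β U ≠ 0) :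
    orbitDist U < δ β :=
  (mem_fatTubeRho_of_recordWeightRho_ne_zero δ ρ δg β hU).2

/-- ★★ **The soft tube statement with free fat radius is INNER one-orbit**: for all positive `δ`, all `ρ ≥ 2δ` and ALL gauge widths `δg`,
`SoftTubeNoIntruderAt L (recordWeightRho δ ρ δg) ↔ InnerNoIntruderOneOrbitAt L δ`. [cite: Luscher1983, §3] -/
theorem softTube_recordWeightRho_iff_inner {δ ρ : ℝ → ℝ} (hδ : ∀ β, 0 < δ β) (hρ : ∀ β, 2 * δ β ≤ ρ β) (δg : ℝ → ℝ) :
    SoftTubeNoIntruderAt L (recordWeightRho L δ ρ δg) ↔ InnerNoIntruderOneOrbitAt L δ :=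
  softTubeNoIntruderAt_iff_inner (softTubeAdmissible_recordWeightRho L hδ hρ) (fun β U => recordWeightRho_nonneg δ ρ δg β U)
    (fun β => ⟨_, Real.exp_pos _, fun _ hU => recordWeightRho_ge_of_ne_zero δ ρ δg β hU⟩)
    ⟨0, fun β _ _ hU => orbitDist_lt_of_recordWeightRho_ne_zero δ ρ δg β hU⟩

/-- ★★ **Lane A's target of record with free fat radius is INNER one-orbit**: `SoftTubeBOPackageAt L (recordWeightRho δ ρ δg) ↔ InnerNoIntruderOneOrbitAt L δ`
(all positive `δ`, all `ρ ≥ 2δ`, all `δg`). [cite: Luscher1983, §3] -/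
theorem softTubeBOPackage_recordWeightRho_iff_inner {δ ρ : ℝ → ℝ} (hδ : ∀ β, 0 < δ β) (hρ : ∀ β, 2 * δ β ≤ ρ β) (δg : ℝ → ℝ) :
    SoftTubeBOPackageAt L (recordWeightRho L δ ρ δg) ↔ InnerNoIntruderOneOrbitAt L δ :=
  (softTubeBOPackageAt_iff _).trans (softTube_recordWeightRho_iff_inner hδ hρ δg)

/-- ★★ The instance of record: core `β^{−s}`, fat radius `M·β^{−s}` (`M ≥ 2`), gauge width `β^{−t}` — INNER one-orbit at `β^{−s}`, for EVERY `t` and EVERY `M ≥ 2`.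
[cite: Luscher1983, §3] -/
theorem softTubeBOPackage_recordWeightRho_pow_iff (s t M : ℝ) (hM : 2 ≤ M) :
    SoftTubeBOPackageAt L (recordWeightRho L (powScale s) (fun β => M * powScale s β) (powScale t)) ↔ InnerNoIntruderOneOrbitAt L (powScale s) :=
  softTubeBOPackage_recordWeightRho_iff_inner (fun β => powScale_pos s β) (fun β => mul_le_mul_of_nonneg_right hM (powScale_pos s β).le) (powScale t)

/-- ★ **`M` and `t` are decorative in the typed target**: the free-radius target of record is equivalent to the old one (`ρ = 2δ`) at ANY gauge width `t'`.
[cite: Luscher1983, §3] -/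
theorem softTubeBOPackage_recordWeightRho_pow_iff_recordWeight (s t t' M : ℝ) (hM : 2 ≤ M) :
    SoftTubeBOPackageAt L (recordWeightRho L (powScale s) (fun β => M * powScale s β) (powScale t)) ↔
      SoftTubeBOPackageAt L (recordWeight L (powScale s) (powScale t')) :=
  (softTubeBOPackage_recordWeightRho_pow_iff s t M hM).trans (softTubeBOPackage_recordWeight_pow_iff s t').symm

/-- ★ … and to R18's `InnerBOPackageAt L (powScale s)`: all typed C4 interfaces still coincide. [cite: Luscher1983, §3] -/
theorem softTubeBOPackage_recordWeightRho_pow_iff_innerBOPackage (s t M : ℝ) (hM : 2 ≤ M) :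
    SoftTubeBOPackageAt L (recordWeightRho L (powScale s) (fun β => M * powScale s β) (powScale t)) ↔ InnerBOPackageAt L (powScale s) :=
  (softTubeBOPackage_recordWeightRho_pow_iff s t M hM).trans (R18.innerBOPackageAt_iff (powScale s)).symm

end Summit.QuantumFields.YangMills.Theorems.TwistedTraceScaling.Negative.R31

end
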